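import Literature.Analysis.FluidPDE.BesovHeatContinuity
import Literature.Analysis.FluidPDE.HeatExtensionDistribution
import Literature.Analysis.FluidPDE.LittlewoodPaleyBlockFn
import Literature.Analysis.FluidPDE.OseenKernelSemigroup
import Literature.Analysis.FluidPDE.OseenKernelLp
import Literature.Analysis.FluidPDE.OseenDuhamelLowFrequency
import HarnessLib

/-!
# The Littlewood–Paley blocks of the Oseen–Koch–Tataru kernel: `L¹` bounds at low and high frequency

Analysis/FluidPDE proof file (no definitions, no named facts). It supplies the kernel
estimates behind the **Besov regularity of the Navier–Stokes Duhamel term**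
`B(u, u)(t) = ∫₀ᵗ e^{(t-s)Δ}ℙ∇·(u ⊗ u)(s) ds` of a Kato-class mild solution
(`kochTataruBilinear`; item "Duhamel term in `C((0,T); Ḃ^{-1+3/p}_{p,q})`" of the local Cauchy
theory `Literature.Analysis.FluidPDE.exists_isBesovMildSolutionOn`, Bahouri–Chemin–Danchin 2011,
Thm. 5.40; Gallagher–Koch–Planchon 2016, §1.2 and App. B, "standard estimates for the linear
Stokes kernel"). The blocks `Δ̇_j B(u,u)(t)` are time integrals of convolutions with the
**blocked kernel** `Δ̇_j K(σ, ·)[a, b] = K_j ⋆ K(σ, ·)[a, b]` (`blockFn j (fun z => oseenKernel σ z a b)`; `K = oseenKernel`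
the kernel of `e^{σΔ}ℙ∇·`, Koch–Tataru 2001, (8); `K_j` the real Littlewood–Paley kernel), and by
Young's inequality with one factor of `u ⊗ u` in `L^p` and one in `L^∞` everything reduces to the
`L¹` norms of these fields, for which this file proves the two complementary bounds

* `exists_lintegral_enorm_oseenKernelBlock_le_low` (**low frequencies**, any dimension): for
  `0 ≤ θ < 1`, `‖Δ̇_j K(σ,·)[a,b]‖_{L¹} ≤ C 2^{jθ} σ^{(θ-1)/2} ‖a‖‖b‖` — the gain `2^{jθ}` from the
  *vanishing mean* of the kernel (`integral_oseenKernel_eq_zero`; on the Fourier side the symbol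
  `2πi⟨ξ,a⟩Ĝ_σ(ξ)ℙ(ξ)b` vanishes at `ξ = 0`), the Lipschitz `L¹` translation modulus of `K₀`
  (`exists_lintegral_enorm_blockKernel_zero_sub_le`: `∫|K₀(y-h)-K₀(y)|dy ≤ C min(1,‖h‖)`, mean
  value inequality and the Schwartz decay of `DK₀`), the dyadic scaling
  `∫|K_j(x-z)-K_j(x)|dx = ∫|K₀(y-2^jz)-K₀(y)|dy` and the moment
  `∫‖z‖^θ(σ+‖z‖²)^{-(d+1)/2}dz ∝ σ^{(θ-1)/2}` of Koch–Tataru's bound (14) (the first moment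
  diverges: the kernel of `e^{σΔ}ℙ∇·` decays like `‖z‖^{-d-1}`, which is why only `θ < 1` —
  enough for the critical theory, which needs some `θ > 1 - 3/p`);
* `exists_lintegral_enorm_oseenKernelBlock_le_high` (**high frequencies**, on `ℝ^ι`):
  `‖Δ̇_j K(σ,·)[a,b]‖_{L¹} ≤ C e^{-cσ2^{2j}} σ^{-1/2} ‖a‖‖b‖` — the kernel semigroup law
  `K(σ,·) = e^{(σ/2)Δ}K(σ/2,·)` (`heatExtension_oseenKernel`), the heat flow of the blocks in `L¹`
  (`gkp_heat_estimate`, read on the `L¹` function `K(σ/2,·)[a,b]` through its tempered distribution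
  with `isDistributionOf_heatExtension_of_eLpNormDistrib_lt_top'` and the dictionary
  `IsDistributionOf.eLpNormDistrib_lpBlock_eq`), Young, and the `L¹` size of (14).

With `γ = 1 - 3/(2p)` the weight of `‖u(s)‖_{L^p}‖u(s)‖_{L^∞} ≲ s^{-γ}` in Kato's class, these give
`2^{js_p}‖Δ̇_j B(u,u)(t)‖_{L^p} ≲ min((4^jt)^{(s_p+θ)/2}, (4^jt)^{-γ})`, an `ℓ^1 ∩ ℓ^∞` profile in
`4^j t` uniformly in `t` (next file). Also: `lintegral_enorm_blockKernel` (`‖K_j‖_{L¹} = ‖K₀‖_{L¹}`),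
`oseenKernelBlock_eq_integral_sub` (the cancellation), `min_one_le_rpow_of_nonneg`.

## References

* H. Koch, D. Tataru, *Well-posedness for the Navier–Stokes equations*, Adv. Math. 157 (2001),
  §2 (8), (14). [KochTataruAdvMath2001]
* H. Bahouri, J.-Y. Chemin, R. Danchin, *Fourier Analysis and Nonlinear PDE* (2011), Lemma 2.4,
  §5.6 (Thm. 5.40). [BahouriCheminDanchin2011]
* I. Gallagher, G. S. Koch, F. Planchon, Comm. Math. Phys. 343 (2016) = arXiv:1407.4156, App. B.
  [GKP2016]
-/

noncomputable section

open MeasureTheory Set Function Filter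
open _root_.Topology
open scoped SchwartzMap ENNReal NNReal RealInnerProductSpace Convolution

namespace Literature.Analysis.FluidPDE

open FunctionSpaces (blockFn blockKernel blockKernelC)

section Low

variable {E : Type*} [NormedAddCommGroup E] [InnerProductSpace ℝ E] [FiniteDimensional ℝ E]
  [MeasurableSpace E] [BorelSpace E]

/-- Unfolding the blocked kernel as the convolution integral `∫ K_j(x - z) K(σ, z)[a, b] dz`.
[folklore] -/
theorem oseenKernelBlock_apply (j : ℤ) (σ : ℝ) (a b x : E) :
    blockFn j (fun z => oseenKernel σ z a b) x = ∫ z, blockKernel E j (x - z) • oseenKernel σ z a b := by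
  rw [FunctionSpaces.blockFn_apply]
  have h := integral_sub_left_eq_self (fun z => blockKernel E j (x - z) • oseenKernel σ z a b)
    (volume : Measure E) x
  simp only [sub_sub_cancel] at h
  exact h

/-- The kernel slice `z ↦ K(σ, z)[a, b]` is integrable for `σ > 0` (Koch–Tataru's bound (14)).
[cite: KochTataruAdvMath2001, Lemma 3.2 (Step 2)] -/
theorem integrable_oseenKernel_left_slice {σ : ℝ} (hσ : 0 < σ) (a b : E) :
    Integrable (fun z : E => oseenKernel σ z a b) := by
  obtain ⟨C, -, hC⟩ := exists_lintegral_enorm_oseenKernel_le (E := E)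
  exact (hC hσ a b).1

/-- Bounded times integrable: `z ↦ K_j(x - z) • K(σ, z)[a, b]` is integrable. [folklore] -/
theorem integrable_blockKernel_sub_smul_oseenKernel (j : ℤ) {σ : ℝ} (hσ : 0 < σ) (a b x : E) :
    Integrable (fun z : E => blockKernel E j (x - z) • oseenKernel σ z a b) := by
  obtain ⟨C, hC⟩ := FunctionSpaces.exists_norm_blockKernel_le (E := E) j
  refine ((integrable_oseenKernel_left_slice hσ a b).norm.const_mul C).mono'
    ((((FunctionSpaces.continuous_blockKernel j).comp (continuous_const.sub continuous_id))
      |>.aestronglyMeasurable).smul (measurable_oseenKernel_left σ a b).aestronglyMeasurable)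
    (Eventually.of_forall fun z => ?_)
  rw [norm_smul]
  exact mul_le_mul_of_nonneg_right (hC _) (norm_nonneg _)

/-- **The cancellation**: since `∫ K(σ, z)[a, b] dz = 0` (the kernel is odd;
`integral_oseenKernel_eq_zero`), the blocked kernel is
`∫ (K_j(x - z) - K_j(x)) K(σ, z)[a, b] dz`. [cite: KochTataruAdvMath2001, §2 (8)] -/
theorem oseenKernelBlock_eq_integral_sub (j : ℤ) {σ : ℝ} (hσ : 0 < σ) (a b x : E) :
    blockFn j (fun z => oseenKernel σ z a b) x =
      ∫ z, (blockKernel E j (x - z) - blockKernel E j x) • oseenKernel σ z a b := by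
  rw [oseenKernelBlock_apply]
  have h0 : ∫ z, blockKernel E j x • oseenKernel σ z a b = 0 := by
    rw [integral_smul, integral_oseenKernel_eq_zero, smul_zero]
  have h2 : Integrable (fun z : E => blockKernel E j x • oseenKernel σ z a b) :=
    (integrable_oseenKernel_left_slice hσ a b).smul _
  simp_rw [sub_smul]
  rw [integral_sub (integrable_blockKernel_sub_smul_oseenKernel j hσ a b x) h2, h0, sub_zero]

/-- Pointwise domination of the blocked kernel by the translation defect of `K_j` against the size
of `K(σ, ·)`. [folklore] -/
theorem enorm_oseenKernelBlock_le (j : ℤ) {σ : ℝ} (hσ : 0 < σ) (a b x : E) :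
    ‖blockFn j (fun z => oseenKernel σ z a b) x‖ₑ ≤
      ∫⁻ z, ‖blockKernel E j (x - z) - blockKernel E j x‖ₑ * ‖oseenKernel σ z a b‖ₑ := by
  rw [oseenKernelBlock_eq_integral_sub j hσ]
  refine (enorm_integral_le_lintegral_enorm _).trans (lintegral_mono fun z => ?_)
  rw [enorm_smul]

/-- **Dyadic scaling of the translation defect**: `∫ |K_j(x - z) - K_j(x)| dx = ∫ |K₀(y - 2^j z) - K₀(y)| dy`
(`K_j = 2^{jd}K₀(2^j ·)`). [folklore] -/
theorem lintegral_enorm_blockKernel_sub_sub (j : ℤ) (z : E) :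
    ∫⁻ x, ‖blockKernel E j (x - z) - blockKernel E j x‖ₑ =
      ∫⁻ y, ‖blockKernel E 0 (y - ((2 : ℝ) ^ j) • z) - blockKernel E 0 y‖ₑ := by
  set d : ℕ := Module.finrank ℝ E with hd
  set c : ℝ := (2 : ℝ) ^ j with hc
  have hc0 : c ≠ 0 := zpow_ne_zero j two_ne_zero
  have hcpos : 0 < c := zpow_pos two_pos j
  set g : E → ℝ := fun y => blockKernel E 0 (y - c • z) - blockKernel E 0 y with hg
  have hscale : ∀ x : E, blockKernel E j (x - z) - blockKernel E j x =
      (2 : ℝ) ^ ((j : ℤ) * (d : ℤ)) * g (c • x) := by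
    intro x
    rw [FunctionSpaces.blockKernel_eq_scale j (x - z), FunctionSpaces.blockKernel_eq_scale j x, hg]
    simp only [smul_sub, hc]
    ring
  have hpow : (2 : ℝ) ^ ((j : ℤ) * (d : ℤ)) = c ^ d := by
    rw [hc, zpow_mul, zpow_natCast]
  have hcd : 0 < c ^ d := pow_pos hcpos d
  simp_rw [hscale, hpow]
  have h1 : ∫⁻ x, ‖c ^ d * g (c • x)‖ₑ = ENNReal.ofReal (c ^ d) * ∫⁻ x, ‖g (c • x)‖ₑ := by
    rw [← lintegral_const_mul' _ _ ENNReal.ofReal_ne_top]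
    refine lintegral_congr fun x => ?_
    rw [enorm_mul, Real.enorm_eq_ofReal hcd.le]
  have h2 : ∫⁻ x, ‖g (c • x)‖ₑ = ENNReal.ofReal |(c ^ d)⁻¹| * ∫⁻ y, ‖g y‖ₑ := by
    have h := FunctionSpaces.eLpNorm_comp_smul (F := ℝ) 1 g hc0
    simp only [eLpNorm_one_eq_lintegral_enorm, ENNReal.toReal_one, div_one,
      ENNReal.rpow_one] at h
    simpa using h
  rw [h1, h2, ← mul_assoc, ← ENNReal.ofReal_mul hcd.le, abs_of_pos (inv_pos.2 hcd),
    mul_inv_cancel₀ hcd.ne', ENNReal.ofReal_one, one_mul]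

/-- **The `L¹` translation modulus of the Littlewood–Paley kernel `K₀` is Lipschitz at the origin
and bounded**: `∫ |K₀(y - h) - K₀(y)| dy ≤ C min(1, ‖h‖)` (Schwartz decay of `DK₀` and the mean
value inequality for `‖h‖ ≤ 1`; `2‖K₀‖_{L¹}` always). [folklore] -/
theorem exists_lintegral_enorm_blockKernel_zero_sub_le :
    ∃ C : ℝ, 0 ≤ C ∧ ∀ h : E,
      ∫⁻ y, ‖blockKernel E 0 (y - h) - blockKernel E 0 y‖ₑ ≤ ENNReal.ofReal (C * min 1 ‖h‖) := by
  set d : ℕ := Module.finrank ℝ E with hd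
  -- the complex kernel and the Schwartz decay of its derivative
  set h₀ : 𝓢(E, ℂ) := blockKernelC E 0 with hh₀
  obtain ⟨CD, hCD0, hCD⟩ := schwartz_exists_norm_comp_add_le (SchwartzMap.fderivCLM ℝ E ℂ h₀)
  set B : E → ℝ := fun y => CD * (1 + (1 : ℝ)) ^ (d + 1) * (1 + ‖y‖) ^ (-((d : ℝ) + 1)) with hB
  have hB0 : ∀ y, 0 ≤ B y := fun y => by positivity
  have hBint : Integrable B := by
    have h := (integrable_one_add_norm (E := E) (μ := volume) (r := (d : ℝ) + 1)
      (by rw [hd]; linarith)).const_mul (CD * (1 + (1 : ℝ)) ^ (d + 1))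
    exact h
  set L : ℝ := ∫ y, B y with hL
  have hL0 : 0 ≤ L := integral_nonneg hB0
  -- the `L¹` norm of `K₀`
  have hK1 : ∫⁻ y, ‖blockKernel E 0 y‖ₑ < ∞ := by
    have h := (FunctionSpaces.memLp_blockKernel (E := E) 0 1).eLpNorm_lt_top
    rwa [eLpNorm_one_eq_lintegral_enorm] at h
  set N : ℝ := (∫⁻ y, ‖blockKernel E 0 y‖ₑ).toReal with hN
  have hN0 : 0 ≤ N := ENNReal.toReal_nonneg
  refine ⟨max L (2 * N), le_max_of_le_left hL0, fun h => ?_⟩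
  by_cases hh : ‖h‖ ≤ 1
  · -- Lipschitz regime: mean value inequality on the ball `closedBall y 1`
    have hpt : ∀ y : E, ‖blockKernel E 0 (y - h) - blockKernel E 0 y‖ ≤ B y * ‖h‖ := by
      intro y
      have hbound : ∀ w ∈ Metric.closedBall y 1, ‖fderiv ℝ (⇑h₀) w‖ ≤ B y := by
        intro w hw
        have hw' : ‖w - y‖ ≤ 1 := by rwa [Metric.mem_closedBall, dist_eq_norm] at hw
        have h1 := hCD 1 zero_le_one (w - y) hw' y
        rw [SchwartzMap.fderivCLM_apply, add_sub_cancel] at h1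
        exact h1
      have hmv := Convex.norm_image_sub_le_of_norm_fderiv_le (f := (⇑h₀ : E → ℂ))
        (fun w _ => h₀.differentiableAt) hbound (convex_closedBall y 1)
        (Metric.mem_closedBall_self zero_le_one)
        (show y - h ∈ Metric.closedBall y 1 by
          rw [Metric.mem_closedBall, dist_eq_norm, sub_sub_cancel_left, norm_neg]; exact hh)
      rw [sub_sub_cancel_left, norm_neg] at hmv
      calc ‖blockKernel E 0 (y - h) - blockKernel E 0 y‖
          = |(h₀ (y - h) - h₀ y).re| := by
            rw [Real.norm_eq_abs, Complex.sub_re]; rfl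
        _ ≤ ‖h₀ (y - h) - h₀ y‖ := Complex.abs_re_le_norm _
        _ ≤ B y * ‖h‖ := hmv
    calc ∫⁻ y, ‖blockKernel E 0 (y - h) - blockKernel E 0 y‖ₑ
        ≤ ∫⁻ y, ENNReal.ofReal (B y * ‖h‖) := lintegral_mono fun y => by
          rw [← ofReal_norm]
          exact ENNReal.ofReal_le_ofReal (hpt y)
      _ = ENNReal.ofReal (L * ‖h‖) := by
          simp_rw [ENNReal.ofReal_mul' (norm_nonneg h)]
          rw [lintegral_mul_const' _ _ ENNReal.ofReal_ne_top,
            ← ofReal_integral_eq_lintegral_ofReal hBint (Eventually.of_forall hB0),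
            ← ENNReal.ofReal_mul hL0]
      _ ≤ ENNReal.ofReal (max L (2 * N) * min 1 ‖h‖) := by
          rw [min_eq_right hh]
          exact ENNReal.ofReal_le_ofReal (mul_le_mul_of_nonneg_right (le_max_left _ _)
            (norm_nonneg _))
  · -- crude regime: twice the `L¹` norm
    push Not at hh
    have htri : ∫⁻ y, ‖blockKernel E 0 (y - h) - blockKernel E 0 y‖ₑ ≤
        (∫⁻ y, ‖blockKernel E 0 (y - h)‖ₑ) + ∫⁻ y, ‖blockKernel E 0 y‖ₑ := by
      calc ∫⁻ y, ‖blockKernel E 0 (y - h) - blockKernel E 0 y‖ₑ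
          ≤ ∫⁻ y, ‖blockKernel E 0 (y - h)‖ₑ + ‖blockKernel E 0 y‖ₑ :=
            lintegral_mono fun y => enorm_sub_le
        _ = (∫⁻ y, ‖blockKernel E 0 (y - h)‖ₑ) + ∫⁻ y, ‖blockKernel E 0 y‖ₑ :=
            lintegral_add_right _ (FunctionSpaces.continuous_blockKernel 0).measurable.enorm
    rw [lintegral_sub_right_eq_self (fun y => ‖blockKernel E 0 y‖ₑ) h] at htri
    refine htri.trans ?_
    rw [min_eq_left hh.le, mul_one, ← ENNReal.ofReal_toReal hK1.ne, ← hN, ← ENNReal.ofReal_add hN0 hN0,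
      ← two_mul]
    exact ENNReal.ofReal_le_ofReal (le_max_right _ _)

/-- `min(1, r) ≤ r^θ` for `r ≥ 0` and `0 ≤ θ ≤ 1`. [folklore] -/
theorem min_one_le_rpow_of_nonneg {r θ : ℝ} (hr : 0 ≤ r) (hθ0 : 0 ≤ θ) (hθ1 : θ ≤ 1) : min 1 r ≤ r ^ θ := by
  rcases le_total r 1 with h | h
  · rw [min_eq_right h]
    rcases hr.eq_or_lt with rfl | hr0
    · exact Real.rpow_nonneg le_rfl _
    · calc r = r ^ (1 : ℝ) := (Real.rpow_one r).symm
        _ ≤ r ^ θ := Real.rpow_le_rpow_of_exponent_ge hr0 h hθ1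
  · rw [min_eq_left h]
    exact Real.one_le_rpow h hθ0

/-- **The low-frequency `L¹` bound of the blocked kernel**: for `0 ≤ θ < 1` there is `C` with
`∫ ‖Δ̇_j K(σ, ·)[a, b]‖ ≤ C 2^{jθ} σ^{(θ-1)/2} ‖a‖ ‖b‖` for all `j ∈ ℤ`, `σ > 0` — the gain `2^{jθ}`
at low frequencies from the vanishing mean of the kernel (its Fourier symbol `2πi⟨ξ,a⟩Ĝ_σ(ξ)ℙ(ξ)b`
vanishes at `ξ = 0`, Koch–Tataru 2001, (8)), the Lipschitz translation modulus of `K₀` in `L¹`,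
`∫|K_j(x-z) - K_j(x)|dx ≤ C min(1, 2^j‖z‖) ≤ C (2^j‖z‖)^θ`, and the moment
`∫ ‖z‖^θ (σ + ‖z‖²)^{-(d+1)/2} dz ∝ σ^{(θ-1)/2}` of the bound (14). (The first moment `θ = 1`
diverges logarithmically: the kernel of `e^{σΔ}ℙ∇·` decays like `‖z‖^{-d-1}`.)
[cite: KochTataruAdvMath2001, §2 (8) and (14)] -/
theorem exists_lintegral_enorm_oseenKernelBlock_le_low {θ : ℝ} (hθ0 : 0 ≤ θ) (hθ1 : θ < 1) :
    ∃ C : ℝ, 0 ≤ C ∧ ∀ (j : ℤ) {σ : ℝ}, 0 < σ → ∀ a b : E,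
      ∫⁻ x, ‖blockFn j (fun z => oseenKernel σ z a b) x‖ₑ ≤
        ENNReal.ofReal (C * (2 : ℝ) ^ ((j : ℝ) * θ) * σ ^ ((θ - 1) / 2) * ‖a‖ * ‖b‖) := by
  set d : ℝ := (Module.finrank ℝ E : ℝ) with hd
  obtain ⟨CK, hCK, hK⟩ := exists_norm_oseenKernel_le (E := E)
  obtain ⟨CΩ, hCΩ0, hΩ⟩ := exists_lintegral_enorm_blockKernel_zero_sub_le (E := E)
  set e : ℝ := (d + 1 - θ) / 2 with he
  have hde : d < 2 * e := by rw [he]; linarith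
  set M : ℝ := ∫ w : E, (1 + ‖w‖ ^ 2) ^ (-e) with hM
  have hM0 : 0 < M := integral_one_add_norm_sq_rpow_neg_pos hde
  refine ⟨CK * CΩ * M, by positivity, fun j {σ} hσ a b => ?_⟩
  set c : ℝ := (2 : ℝ) ^ j with hc
  have hcpos : 0 < c := zpow_pos two_pos j
  have hcθ : c ^ θ = (2 : ℝ) ^ ((j : ℝ) * θ) := by
    rw [hc, ← Real.rpow_intCast, ← Real.rpow_mul zero_le_two]
  -- ### Tonelli
  have hmeasK : Measurable fun z : E => oseenKernel σ z a b := measurable_oseenKernel_left σ a b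
  have hmeasD : Measurable fun q : E × E => ‖blockKernel E j (q.1 - q.2) - blockKernel E j q.1‖ₑ *
      ‖oseenKernel σ q.2 a b‖ₑ :=
    ((((FunctionSpaces.continuous_blockKernel j).comp (continuous_fst.sub continuous_snd)).sub
      ((FunctionSpaces.continuous_blockKernel j).comp continuous_fst)).measurable.enorm).mul
      (hmeasK.comp measurable_snd).enorm
  have hT : ∫⁻ x, ‖blockFn j (fun z => oseenKernel σ z a b) x‖ₑ ≤
      ∫⁻ z, ‖oseenKernel σ z a b‖ₑ * ∫⁻ x, ‖blockKernel E j (x - z) - blockKernel E j x‖ₑ := by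
    calc ∫⁻ x, ‖blockFn j (fun z => oseenKernel σ z a b) x‖ₑ
        ≤ ∫⁻ x, ∫⁻ z, ‖blockKernel E j (x - z) - blockKernel E j x‖ₑ * ‖oseenKernel σ z a b‖ₑ :=
          lintegral_mono fun x => enorm_oseenKernelBlock_le j hσ a b x
      _ = ∫⁻ z, ∫⁻ x, ‖blockKernel E j (x - z) - blockKernel E j x‖ₑ * ‖oseenKernel σ z a b‖ₑ :=
          lintegral_lintegral_swap hmeasD.aemeasurable
      _ = ∫⁻ z, ‖oseenKernel σ z a b‖ₑ * ∫⁻ x, ‖blockKernel E j (x - z) - blockKernel E j x‖ₑ := by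
          refine lintegral_congr fun z => ?_
          rw [lintegral_mul_const' _ _ enorm_ne_top, mul_comm]
  refine hT.trans ?_
  -- ### pointwise bound of the integrand in `z`
  have hpt : ∀ z : E, ‖oseenKernel σ z a b‖ₑ * ∫⁻ x, ‖blockKernel E j (x - z) - blockKernel E j x‖ₑ ≤
      ENNReal.ofReal (CK * CΩ * ‖a‖ * ‖b‖ * c ^ θ) * ENNReal.ofReal ((σ + ‖z‖ ^ 2) ^ (-e)) := by
    intro z
    have hsz : 0 < σ + ‖z‖ ^ 2 := by positivity
    rw [lintegral_enorm_blockKernel_sub_sub j z]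
    have h1 : ‖oseenKernel σ z a b‖ₑ ≤
        ENNReal.ofReal (CK * (σ + ‖z‖ ^ 2) ^ (-((d + 1) / 2)) * ‖a‖ * ‖b‖) := by
      rw [← ofReal_norm]
      exact ENNReal.ofReal_le_ofReal (hK hσ z a b)
    have h2 : ∫⁻ y, ‖blockKernel E 0 (y - c • z) - blockKernel E 0 y‖ₑ ≤
        ENNReal.ofReal (CΩ * (c * ‖z‖) ^ θ) := by
      refine (hΩ (c • z)).trans (ENNReal.ofReal_le_ofReal ?_)
      rw [norm_smul, Real.norm_of_nonneg hcpos.le]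
      exact mul_le_mul_of_nonneg_left (min_one_le_rpow_of_nonneg (by positivity) hθ0 hθ1.le) hCΩ0
    have h3 : (c * ‖z‖) ^ θ * (σ + ‖z‖ ^ 2) ^ (-((d + 1) / 2)) ≤ c ^ θ * (σ + ‖z‖ ^ 2) ^ (-e) := by
      rw [Real.mul_rpow hcpos.le (norm_nonneg _), mul_assoc]
      refine mul_le_mul_of_nonneg_left ?_ (Real.rpow_nonneg hcpos.le _)
      have hzθ : ‖z‖ ^ θ ≤ (σ + ‖z‖ ^ 2) ^ (θ / 2) := by
        calc ‖z‖ ^ θ = (‖z‖ ^ 2) ^ (θ / 2) := by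
              rw [← Real.rpow_natCast, ← Real.rpow_mul (norm_nonneg _)]
              congr 1; push_cast; ring
          _ ≤ (σ + ‖z‖ ^ 2) ^ (θ / 2) :=
              Real.rpow_le_rpow (by positivity) (by linarith) (by linarith)
      calc ‖z‖ ^ θ * (σ + ‖z‖ ^ 2) ^ (-((d + 1) / 2))
          ≤ (σ + ‖z‖ ^ 2) ^ (θ / 2) * (σ + ‖z‖ ^ 2) ^ (-((d + 1) / 2)) :=
            mul_le_mul_of_nonneg_right hzθ (Real.rpow_nonneg hsz.le _)
        _ = (σ + ‖z‖ ^ 2) ^ (-e) := by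
            rw [← Real.rpow_add hsz, he]; congr 1; ring
    calc ‖oseenKernel σ z a b‖ₑ * ∫⁻ y, ‖blockKernel E 0 (y - c • z) - blockKernel E 0 y‖ₑ
        ≤ ENNReal.ofReal (CK * (σ + ‖z‖ ^ 2) ^ (-((d + 1) / 2)) * ‖a‖ * ‖b‖) *
            ENNReal.ofReal (CΩ * (c * ‖z‖) ^ θ) := mul_le_mul' h1 h2
      _ = ENNReal.ofReal (CK * CΩ * ‖a‖ * ‖b‖ *
            ((c * ‖z‖) ^ θ * (σ + ‖z‖ ^ 2) ^ (-((d + 1) / 2)))) := by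
          rw [← ENNReal.ofReal_mul (by positivity)]
          congr 1; ring
      _ ≤ ENNReal.ofReal (CK * CΩ * ‖a‖ * ‖b‖ * (c ^ θ * (σ + ‖z‖ ^ 2) ^ (-e))) :=
          ENNReal.ofReal_le_ofReal (mul_le_mul_of_nonneg_left h3 (by positivity))
      _ = ENNReal.ofReal (CK * CΩ * ‖a‖ * ‖b‖ * c ^ θ) * ENNReal.ofReal ((σ + ‖z‖ ^ 2) ^ (-e)) := by
          rw [← ENNReal.ofReal_mul (by positivity)]
          congr 1; ring
  -- ### integrate the weight
  have hscal : d / 2 - e = (θ - 1) / 2 := by rw [he]; ring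
  calc ∫⁻ z, ‖oseenKernel σ z a b‖ₑ * ∫⁻ x, ‖blockKernel E j (x - z) - blockKernel E j x‖ₑ
      ≤ ∫⁻ z, ENNReal.ofReal (CK * CΩ * ‖a‖ * ‖b‖ * c ^ θ) * ENNReal.ofReal ((σ + ‖z‖ ^ 2) ^ (-e)) :=
        lintegral_mono hpt
    _ = ENNReal.ofReal (CK * CΩ * ‖a‖ * ‖b‖ * c ^ θ) * ENNReal.ofReal (σ ^ (d / 2 - e) * M) := by
        rw [lintegral_const_mul' _ _ ENNReal.ofReal_ne_top, lintegral_add_norm_sq_rpow_neg hde hσ]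
    _ = ENNReal.ofReal (CK * CΩ * M * (2 : ℝ) ^ ((j : ℝ) * θ) * σ ^ ((θ - 1) / 2) * ‖a‖ * ‖b‖) := by
        rw [← ENNReal.ofReal_mul (by positivity), hscal, hcθ]
        congr 1; ring

end Low

end Literature.Analysis.FluidPDE

namespace Literature.Analysis.FluidPDE

open FunctionSpaces (blockFn blockKernel blockKernelC)

section L1Kernel

variable {E : Type*} [NormedAddCommGroup E] [InnerProductSpace ℝ E] [FiniteDimensional ℝ E]
  [MeasurableSpace E] [BorelSpace E]

/-- **The `L¹` norm of the Littlewood–Paley kernel is scale invariant**: `∫ |K_j| = ∫ |K₀|`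
(`K_j = 2^{jd}K₀(2^j ·)`). [folklore] -/
theorem lintegral_enorm_blockKernel (j : ℤ) :
    ∫⁻ x, ‖blockKernel E j x‖ₑ = ∫⁻ y, ‖blockKernel E 0 y‖ₑ := by
  set d : ℕ := Module.finrank ℝ E with hd
  set c : ℝ := (2 : ℝ) ^ j with hc
  have hc0 : c ≠ 0 := zpow_ne_zero j two_ne_zero
  have hcpos : 0 < c := zpow_pos two_pos j
  have hpow : (2 : ℝ) ^ ((j : ℤ) * (d : ℤ)) = c ^ d := by
    rw [hc, zpow_mul, zpow_natCast]
  have hcd : 0 < c ^ d := pow_pos hcpos d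
  have hscale : ∀ x : E, blockKernel E j x = c ^ d * blockKernel E 0 (c • x) := fun x => by
    rw [FunctionSpaces.blockKernel_eq_scale j x, hpow]
  simp_rw [hscale]
  have h1 : ∫⁻ x, ‖c ^ d * blockKernel E 0 (c • x)‖ₑ =
      ENNReal.ofReal (c ^ d) * ∫⁻ x, ‖blockKernel E 0 (c • x)‖ₑ := by
    rw [← lintegral_const_mul' _ _ ENNReal.ofReal_ne_top]
    refine lintegral_congr fun x => ?_
    rw [enorm_mul, Real.enorm_eq_ofReal hcd.le]
  have h2 : ∫⁻ x, ‖blockKernel E 0 (c • x)‖ₑ = ENNReal.ofReal |(c ^ d)⁻¹| * ∫⁻ y, ‖blockKernel E 0 y‖ₑ := by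
    have h := FunctionSpaces.eLpNorm_comp_smul (F := ℝ) 1 (blockKernel E 0) hc0
    simp only [eLpNorm_one_eq_lintegral_enorm, ENNReal.toReal_one, div_one,
      ENNReal.rpow_one] at h
    simpa using h
  rw [h1, h2, ← mul_assoc, ← ENNReal.ofReal_mul hcd.le, abs_of_pos (inv_pos.2 hcd),
    mul_inv_cancel₀ hcd.ne', ENNReal.ofReal_one, one_mul]

/-- The `L¹` norm of the Littlewood–Paley kernels is finite (and independent of `j`). [folklore] -/
theorem lintegral_enorm_blockKernel_lt_top (j : ℤ) : ∫⁻ x, ‖blockKernel E j x‖ₑ < ∞ := by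
  rw [lintegral_enorm_blockKernel j]
  have h := (FunctionSpaces.memLp_blockKernel (E := E) 0 1).eLpNorm_lt_top
  rwa [eLpNorm_one_eq_lintegral_enorm] at h

end L1Kernel

/-! ## The high-frequency `L¹` bound: the heat structure `K(σ) = e^{(σ/2)Δ}K(σ/2)` -/

section High

variable {ι : Type*} [Fintype ι]

/-- **The high-frequency `L¹` bound of the blocked kernel**: there are `C` and `c > 0` with
`∫ ‖Δ̇_j K(σ, ·)[a, b]‖ ≤ C e^{-c σ 2^{2j}} σ^{-1/2} ‖a‖ ‖b‖` for all `j ∈ ℤ`, `σ > 0` — the kernel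
semigroup law `K(σ, ·) = e^{(σ/2)Δ} K(σ/2, ·)` (`heatExtension_oseenKernel`), the heat flow of the
blocks in `L¹`, `‖Δ̇_j e^{tΔ} f‖_{L¹} ≤ c₀ e^{-ct2^{2j}} ‖Δ̇_j f‖_{L¹}` (`gkp_heat_estimate`, read on
the `L¹` function `K(σ/2, ·)[a, b]` through its tempered distribution), Young
`‖Δ̇_j f‖_{L¹} ≤ ‖K₀‖_{L¹}‖f‖_{L¹}` and the `L¹` size `‖K(σ/2, ·)[a,b]‖_{L¹} ≤ C σ^{-1/2}‖a‖‖b‖` of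
Koch–Tataru's bound (14) (BCD Lemma 2.4; GKP 2016, App. B). On `ℝ^ι` (the blocks of vector fields
are read through `IsDistributionOf`). [cite: GKP2016, App. B (heat estimate)] -/
theorem exists_lintegral_enorm_oseenKernelBlock_le_high :
    ∃ (C c : ℝ), 0 ≤ C ∧ 0 < c ∧ ∀ (j : ℤ) {σ : ℝ}, 0 < σ → ∀ a b : EuclideanSpace ℝ ι,
      ∫⁻ x, ‖blockFn j (fun z => oseenKernel σ z a b) x‖ₑ ≤
        ENNReal.ofReal (C * Real.exp (-(c * σ * 2 ^ (2 * j))) * σ ^ (-(1 / 2 : ℝ)) * ‖a‖ * ‖b‖) := by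
  haveI h11 : Fact ((1 : ℝ≥0∞) ≤ 1) := ⟨le_rfl⟩
  obtain ⟨c₀, c, hc, hheat⟩ := FunctionSpaces.gkp_heat_estimate (E := EuclideanSpace ℝ ι)
    (F := EuclideanSpace ℂ ι) 1
  obtain ⟨CK, hCK, hK⟩ := exists_lintegral_enorm_oseenKernel_le (E := EuclideanSpace ℝ ι)
  have hK1top := lintegral_enorm_blockKernel_lt_top (E := EuclideanSpace ℝ ι) 0
  set K₁ : ℝ := (∫⁻ y, ‖blockKernel (EuclideanSpace ℝ ι) 0 y‖ₑ).toReal with hK₁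
  have hK₁0 : 0 ≤ K₁ := ENNReal.toReal_nonneg
  refine ⟨(c₀ : ℝ) * K₁ * CK * (2 : ℝ) ^ (1 / 2 : ℝ), c / 2, by positivity, by positivity,
    fun j {σ} hσ a b => ?_⟩
  have hσ2 : 0 < σ / 2 := half_pos hσ
  -- the half-time slice as an `L¹` function with a tempered distribution
  set f : EuclideanSpace ℝ ι → EuclideanSpace ℝ ι := fun z => oseenKernel (σ / 2) z a b with hf
  have hf1 : MemLp f 1 volume := memLp_one_iff_integrable.2 (integrable_oseenKernel_left_slice hσ2 a b)
  set g : Lp (EuclideanSpace ℂ ι) 1 (volume : Measure (EuclideanSpace ℝ ι)) :=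
    (memLp_complexify_comp hf1).toLp _ with hg
  have hdist : IsDistributionOf f (g : 𝓢'(EuclideanSpace ℝ ι, EuclideanSpace ℂ ι)) :=
    isDistributionOf_toTemperedDistribution hf1
  have hfin : FunctionSpaces.eLpNormDistrib 1 (TemperedDistribution.heatSemigroup (σ / 2)
      (g : 𝓢'(EuclideanSpace ℝ ι, EuclideanSpace ℂ ι))) < ∞ :=
    (eLpNormDistrib_heatSemigroup_coe_le g hσ2.le).trans_lt enorm_lt_top
  obtain ⟨hheatdist, hheatmem⟩ :=
    isDistributionOf_heatExtension_of_eLpNormDistrib_lt_top' hdist hσ2 hfin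
  -- the semigroup law for the kernel
  have hKeq : (fun z => oseenKernel σ z a b) = UnboundedOperators.heatExtension f (σ / 2) := by
    funext x
    rw [hf, heatExtension_oseenKernel hσ2 hσ2 a b x, add_halves]
  -- the chain of estimates
  have hblock1 : MemLp (blockFn j (UnboundedOperators.heatExtension f (σ / 2))) 1 volume :=
    FunctionSpaces.memLp_blockFn j hheatmem le_rfl
  have hstep1 : ∫⁻ x, ‖blockFn j (fun z => oseenKernel σ z a b) x‖ₑ =
      FunctionSpaces.eLpNormDistrib 1 (FunctionSpaces.lpBlock j
        (TemperedDistribution.heatSemigroup (σ / 2) (g : 𝓢'(EuclideanSpace ℝ ι, EuclideanSpace ℂ ι)))) := by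
    rw [hheatdist.eLpNormDistrib_lpBlock_eq hheatmem j hblock1, eLpNorm_one_eq_lintegral_enorm,
      hKeq]
  have hstep2 : FunctionSpaces.eLpNormDistrib 1 (FunctionSpaces.lpBlock j
      (g : 𝓢'(EuclideanSpace ℝ ι, EuclideanSpace ℂ ι))) ≤
      ENNReal.ofReal K₁ * (ENNReal.ofReal (CK * (σ / 2) ^ (-(1 / 2 : ℝ))) * ‖a‖ₑ * ‖b‖ₑ) := by
    rw [hdist.eLpNormDistrib_lpBlock_eq hf1 j (FunctionSpaces.memLp_blockFn j hf1 le_rfl)]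
    calc eLpNorm (blockFn j f) 1 volume
        ≤ (∫⁻ y, ‖blockKernel (EuclideanSpace ℝ ι) j y‖ₑ) * eLpNorm f 1 volume :=
          FunctionSpaces.eLpNorm_blockFn_le j hf1.1 le_rfl
      _ = ENNReal.ofReal K₁ * ∫⁻ z, ‖f z‖ₑ := by
          rw [lintegral_enorm_blockKernel j, hK₁, ENNReal.ofReal_toReal hK1top.ne,
            eLpNorm_one_eq_lintegral_enorm]
      _ ≤ ENNReal.ofReal K₁ * (ENNReal.ofReal (CK * (σ / 2) ^ (-(1 / 2 : ℝ))) * ‖a‖ₑ * ‖b‖ₑ) := by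
          gcongr
          exact (hK hσ2 a b).2
  have hhalf : (σ / 2) ^ (-(1 / 2 : ℝ)) = (2 : ℝ) ^ (1 / 2 : ℝ) * σ ^ (-(1 / 2 : ℝ)) := by
    rw [div_eq_mul_inv, Real.mul_rpow hσ.le (by norm_num), Real.inv_rpow zero_le_two,
      ← Real.rpow_neg zero_le_two, neg_neg, mul_comm]
  calc ∫⁻ x, ‖blockFn j (fun z => oseenKernel σ z a b) x‖ₑ
      = FunctionSpaces.eLpNormDistrib 1 (FunctionSpaces.lpBlock j
          (TemperedDistribution.heatSemigroup (σ / 2)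
            (g : 𝓢'(EuclideanSpace ℝ ι, EuclideanSpace ℂ ι)))) := hstep1
    _ ≤ c₀ * ENNReal.ofReal (Real.exp (-(c * (σ / 2) * 2 ^ (2 * j)))) *
          FunctionSpaces.eLpNormDistrib 1 (FunctionSpaces.lpBlock j
            (g : 𝓢'(EuclideanSpace ℝ ι, EuclideanSpace ℂ ι))) := hheat (σ / 2) hσ2.le j _
    _ ≤ c₀ * ENNReal.ofReal (Real.exp (-(c * (σ / 2) * 2 ^ (2 * j)))) *
          (ENNReal.ofReal K₁ * (ENNReal.ofReal (CK * (σ / 2) ^ (-(1 / 2 : ℝ))) * ‖a‖ₑ * ‖b‖ₑ)) := by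
        gcongr
    _ = ENNReal.ofReal ((c₀ : ℝ) * K₁ * CK * (2 : ℝ) ^ (1 / 2 : ℝ) *
          Real.exp (-(c / 2 * σ * 2 ^ (2 * j))) * σ ^ (-(1 / 2 : ℝ)) * ‖a‖ * ‖b‖) := by
        rw [← ofReal_norm a, ← ofReal_norm b, hhalf,
          show -(c * (σ / 2) * (2 : ℝ) ^ (2 * j)) = -(c / 2 * σ * 2 ^ (2 * j)) by ring]
        have hc₀ : (c₀ : ℝ≥0∞) = ENNReal.ofReal (c₀ : ℝ) := by simp
        rw [hc₀]
        have hσp : 0 ≤ σ ^ (-(1 / 2 : ℝ)) := Real.rpow_nonneg hσ.le _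
        simp (disch := positivity) only [ENNReal.ofReal_mul]
        ring

end High

end Literature.Analysis.FluidPDE
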